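import Summits.Ventures.HSemireg.Mod4LeadingTermMiddle
import Summits.Ventures.HSemireg.Mod4PureMiddleSpectrum

/-!
# Venture HSemireg — MOD-4 line: the `ch(O_Z)`-SHAPE h-parts (`q_0 = ⋯ = q_{n-1} = 0`, `q_n ≠ 0`, ANY tail `q_{n+1}, …, q_{2n}`)
# AT THE PINS `t = (−1)ⁿ C(n,a)² q_n²`: `1 ≤ dim ker(M_f(q) − t) ≤ 2`; `= 1` at the self-dual pin `2a = n`; `= 2` for odd `n` — every `n`, every tail

HONEST FRAMING. Part of the Lean index of the computation cell `pub-hsemireg` (seat w3-mod4-1 gen 14, W3 SPECIAL FIBRES; file of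
record `HOME/widen/W3/MOD4-OFFSPLIT-w3mod4.md` §8 TABLE R rows «q_n η_n + … + q_{2n} η_{2n} + w» (`ch(O_Z)` generic ∕ middle +
points): middle entry drops `24 → 23` (`n = 2`), `112 → 110` (`n = 3`), `480 → 478 ∕ 479` (`n = 4`, kit j179422) on the locus
`(w,w)_χ = 2Dq_n²`; §13.23 NET «ON the pin set the drop (1 or 2) depends on the tail and is NOT treated»). ELEMENTARY LINEAR ALGEBRA
over a field ONLY: no abelian variety, no sheaf, no Ext group, no semiregularity map; nothing here says that HC / HC_CM / HC_AV
holds; no Literature fact is declared; NO definition is introduced.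

WHAT IS PROVED (`K` a field of characteristic `0`; `q_m = 0` for `m < n`, `q_n ≠ 0`, `a ≤ n`, `t = (−1)ⁿ C(n,a)² q_n²`):
* **`det_middleM_leading_sub_pin`** — `det(M_f(q) − t) = 0` (`M_f(q) − t` is upper triangular, `Mod4LeadingTermMiddle`, with the
  diagonal entry `(−1)ⁿ(C(n,b)² − C(n,a)²)q_n²` vanishing at `b = a`); hence **`one_le_finrank_ker_middleM_leading_pin`** — `1 ≤ dim ker(M_f(q) − t)`:
  EVERY pin is met by every tail (the middle entry always drops there);
* **`eq_zero_of_mem_ker_middleM_leading_pin`** — a kernel vector with `v_a = v_{n−a} = 0` is `0` (back substitution: the other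
  pivots `(−1)ⁿ(C(n,b)² − C(n,a)²)q_n²`, `b ∉ {a, n−a}`, are non-zero by `choose_eq_choose_iff`); hence
  **`finrank_ker_middleM_leading_pin_le_two`** — `dim ker(M_f(q) − t) ≤ 2`, and **`finrank_ker_middleM_leading_pin_self_dual`** —
  at the self-dual pin `2a = n`: `dim ker(M_f(q) − t) = 1` for every tail;
* **`finrank_ker_middleM_leading_pin_odd`** — `n` ODD: `dim ker(M_f(q) − t) = 2` at every pin for every tail (`M_f = (−1)ⁿ T_f²` with
  `T_f` triangular, `Mod4MiddleMatrixSquareRoot`; `T_f` has the eigenvalues `μ = (−1)^a C(n,a) q_n` at entry `a` and `−μ` at entry `n − a`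
  — opposite parity since `n` is odd —, their eigenvectors are independent and lie in `ker(M_f − (−1)ⁿμ²)`:
  `exists_eigenvector_hankelT_leading`, `mem_ker_middleM_of_hankelT_eigenvector`).
With FILE 13's `finrank_S_weilType_middle` (`r_n = n + 1`): at every pin the middle entry of a `ch(O_Z)`-shape row is
`(n+3)C(2n,n) − 2(n+1) − 1` or `− 2` (`Mod4PureMiddleSpectrum`: `− 2` for the pure shape off the self-dual pin), and exactly `− 1` at the
self-dual pin, exactly `− 2` for odd `n` — `n = 2`: `{22, 23}` at `q₂²`, `23` at `4q₂²`; `n = 3`: `110` at `−q₃²` and `−9q₃²`, every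
tail; `n = 4`: `{478, 479}` at `q₄², 16q₄²`, `479` at `36q₄²` (§8: `478` pure ∕ `479` generic at `q₄²`). For even `n` off the self-dual pin the
choice `1 ∕ 2` is ONE polynomial condition on the tail (`n = 2`, pin `q₂²`: drop `2` iff `3q₂q₄ = 2q₃²` — pencil + machine, not typed here).
Everything PROVED, 0 sorry. Namespace `Summit.Ventures.HSemireg.Mod4`.
References: [BourbakiAlgebre1a3] Ch. III §8 (determinant of a triangular matrix, rank); [BuchweitzFlenner2008HH] Prop. 6.4.4.
-/

namespace Summit.Ventures.HSemireg.Mod4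

open Finset Matrix

variable {K : Type*} [Field K]

/-- **`M_f(q) − t` is upper triangular** for `q_m = 0` (`m < n`). [cite: BourbakiAlgebre1a3, Ch. III §8] -/
theorem blockTriangular_middleM_leading_sub {n : ℕ} {q : ℕ → K} (hq0 : ∀ m, m < n → q m = 0) (t : K) :
    (middleM n q - t • (1 : Matrix (Fin (n + 1)) (Fin (n + 1)) K)).BlockTriangular id := by
  intro i j hij
  have hne : i ≠ j := fun h => by rw [h] at hij; exact lt_irrefl _ hij
  rw [Matrix.sub_apply, Matrix.smul_apply, Matrix.one_apply_ne hne, smul_zero, sub_zero]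
  exact middleM_leading_apply_of_lt hq0 i j hij

/-- **the diagonal of `M_f(q) − t` at the pin `t = (−1)ⁿ C(n,a)² q_n²`:** entry `b` is `(−1)ⁿ (C(n,b)² − C(n,a)²) q_n²`, and it is
non-zero iff `C(n,b) ≠ C(n,a)`, i.e. iff `b ∉ {a, n − a}` (`CharZero K`, `q_n ≠ 0`). [cite: BourbakiAlgebre1a3, Ch. III §8] -/
theorem middleM_leading_sub_pin_diag_ne_zero_iff [CharZero K] {n : ℕ} {q : ℕ → K} (hq0 : ∀ m, m < n → q m = 0) (hqn : q n ≠ 0)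
    {a : ℕ} (ha : a ≤ n) {t : K} (ht : t = (-1 : K) ^ n * ((n.choose a : K) * (n.choose a : K)) * (q n * q n))
    (b : Fin (n + 1)) :
    (middleM n q - t • (1 : Matrix (Fin (n + 1)) (Fin (n + 1)) K)) b b ≠ 0 ↔ ¬((b : ℕ) = a ∨ (b : ℕ) + a = n) := by
  have hb := b.isLt
  rw [← choose_eq_choose_iff ha (by omega), Matrix.sub_apply, Matrix.smul_apply, Matrix.one_apply_eq, smul_eq_mul, mul_one,
    middleM_leading_apply_diag hq0 b, ht, not_iff_not]
  have hu : ((-1 : K) ^ n * (q n * q n)) ≠ 0 := mul_ne_zero (pow_ne_zero _ (neg_ne_zero.mpr one_ne_zero)) (mul_ne_zero hqn hqn)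
  constructor
  · intro h
    have h1 : ((-1 : K) ^ n * (q n * q n)) * (((n.choose (b : ℕ) : K)) ^ 2 - ((n.choose a : K)) ^ 2) = 0 := by
      linear_combination h
    have h2 : ((n.choose (b : ℕ) : K)) ^ 2 = ((n.choose a : K)) ^ 2 := sub_eq_zero.mp ((mul_eq_zero.mp h1).resolve_left hu)
    have h3 : ((n.choose (b : ℕ) ^ 2 : ℕ) : K) = ((n.choose a ^ 2 : ℕ) : K) := by push_cast; exact h2
    exact Nat.pow_left_injective two_ne_zero (Nat.cast_injective h3)
  · intro h
    rw [h, sub_self]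

/-- **every pin is met:** `det(M_f(q) − t) = 0` at `t = (−1)ⁿ C(n,a)² q_n²` (`a ≤ n`) for `q_m = 0` (`m < n`) — the product of the
diagonal of a triangular matrix, whose factor `b = a` vanishes. [cite: BourbakiAlgebre1a3, Ch. III §8] -/
theorem det_middleM_leading_sub_pin {n : ℕ} {q : ℕ → K} (hq0 : ∀ m, m < n → q m = 0) {a : ℕ} (ha : a ≤ n) {t : K}
    (ht : t = (-1 : K) ^ n * ((n.choose a : K) * (n.choose a : K)) * (q n * q n)) :
    (middleM n q - t • (1 : Matrix (Fin (n + 1)) (Fin (n + 1)) K)).det = 0 := by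
  rw [Matrix.det_of_upperTriangular (blockTriangular_middleM_leading_sub hq0 t)]
  refine Finset.prod_eq_zero (Finset.mem_univ (⟨a, by omega⟩ : Fin (n + 1))) ?_
  rw [Matrix.sub_apply, Matrix.smul_apply, Matrix.one_apply_eq, smul_eq_mul, mul_one,
    middleM_leading_apply_diag hq0, ht]
  exact sub_self _

/-- `toLin' M − t • id = toLin' (M − t • 1)`. -/
theorem toLin'_sub_smul_id {m : Type*} [Fintype m] [DecidableEq m] (M : Matrix m m K) (t : K) :
    Matrix.toLin' M - t • LinearMap.id = Matrix.toLin' (M - t • (1 : Matrix m m K)) := by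
  rw [map_sub, map_smul, Matrix.toLin'_one]

/-- **`1 ≤ dim ker(M_f(q) − t)` at every pin** `t = (−1)ⁿ C(n,a)² q_n²`, `a ≤ n`, for `q_m = 0` (`m < n`) and ANY tail
`q_{n+1}, …, q_{2n}`: a singular matrix has a non-zero kernel vector. [cite: BourbakiAlgebre1a3, Ch. III §8]
[cite: BuchweitzFlenner2008HH, Prop. 6.4.4] -/
theorem one_le_finrank_ker_middleM_leading_pin {n : ℕ} {q : ℕ → K} (hq0 : ∀ m, m < n → q m = 0) {a : ℕ} (ha : a ≤ n) {t : K}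
    (ht : t = (-1 : K) ^ n * ((n.choose a : K) * (n.choose a : K)) * (q n * q n)) :
    1 ≤ Module.finrank K ↥(LinearMap.ker (Matrix.toLin' (middleM n q) - t • LinearMap.id)) := by
  obtain ⟨v, hv0, hv⟩ := Matrix.exists_mulVec_eq_zero_iff.mpr (det_middleM_leading_sub_pin hq0 ha ht)
  have hmem : v ∈ LinearMap.ker (Matrix.toLin' (middleM n q) - t • LinearMap.id) := by
    rw [toLin'_sub_smul_id, LinearMap.mem_ker, Matrix.toLin'_apply, hv]
  rw [Nat.one_le_iff_ne_zero]
  intro h0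
  rw [Submodule.finrank_eq_zero] at h0
  rw [h0, Submodule.mem_bot] at hmem
  exact hv0 hmem

/-- **back substitution with the two zero pivots removed:** at the pin `t = (−1)ⁿ C(n,a)² q_n²` a kernel vector of `M_f(q) − t`
with `v_a = 0` and `v_{n−a} = 0` vanishes (the remaining pivots are non-zero by `middleM_leading_sub_pin_diag_ne_zero_iff`).
[cite: BourbakiAlgebre1a3, Ch. III §8] -/
theorem eq_zero_of_mem_ker_middleM_leading_pin [CharZero K] {n : ℕ} {q : ℕ → K} (hq0 : ∀ m, m < n → q m = 0) (hqn : q n ≠ 0)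
    {a : ℕ} (ha : a ≤ n) {t : K} (ht : t = (-1 : K) ^ n * ((n.choose a : K) * (n.choose a : K)) * (q n * q n))
    {v : Fin (n + 1) → K} (hv : v ∈ LinearMap.ker (Matrix.toLin' (middleM n q) - t • LinearMap.id))
    (hva : v ⟨a, by omega⟩ = 0) (hvna : v ⟨n - a, by omega⟩ = 0) : v = 0 := by
  rw [toLin'_sub_smul_id, LinearMap.mem_ker, Matrix.toLin'_apply] at hv
  set N := middleM n q - t • (1 : Matrix (Fin (n + 1)) (Fin (n + 1)) K) with hN
  -- row `b` of `N v = 0`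
  have hrow : ∀ b : Fin (n + 1), ∑ c : Fin (n + 1), N b c * v c = 0 := by
    intro b
    have h := congr_fun hv b
    simp only [Matrix.mulVec, dotProduct, Pi.zero_apply] at h
    exact h
  -- `v (n - j) = 0` by strong induction on `j`
  have key : ∀ j, j ≤ n → v ⟨n - j, by omega⟩ = 0 := by
    intro j
    refine Nat.strong_induction_on j ?_
    intro j ih hj
    set b : Fin (n + 1) := ⟨n - j, by omega⟩ with hb
    by_cases hz : ((b : ℕ) = a ∨ (b : ℕ) + a = n)
    · -- one of the two removed pivots: the hypothesis
      rcases hz with h1 | h1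
      · have : b = ⟨a, by omega⟩ := Fin.ext h1
        rw [this]; exact hva
      · have : b = ⟨n - a, by omega⟩ := Fin.ext (by simp only [hb] at h1 ⊢; omega)
        rw [this]; exact hvna
    · have h := hrow b
      rw [Finset.sum_eq_single b] at h
      · rcases mul_eq_zero.mp h with h1 | h1
        · exact absurd h1 ((middleM_leading_sub_pin_diag_ne_zero_iff hq0 hqn ha ht b).mpr hz)
        · exact h1
      · intro c _ hc
        have hcl := c.isLt
        by_cases hlt : (b : ℕ) < (c : ℕ)
        · have h' := ih (n - (c : ℕ)) (by simp only [hb] at hlt; omega) (by omega)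
          have hfin : (⟨n - (n - (c : ℕ)), by omega⟩ : Fin (n + 1)) = c := Fin.ext (by simp only; omega)
          rw [hfin] at h'
          rw [h', mul_zero]
        · have hcb : (c : ℕ) < (b : ℕ) := by
            have : (c : ℕ) ≠ (b : ℕ) := fun h => hc (Fin.ext h)
            omega
          rw [hN, blockTriangular_middleM_leading_sub hq0 t hcb, zero_mul]
      · intro h
        exact absurd (Finset.mem_univ _) h
  funext i
  have hi := i.isLt
  have h := key (n - (i : ℕ)) (by omega)
  have hfin : (⟨n - (n - (i : ℕ)), by omega⟩ : Fin (n + 1)) = i := Fin.ext (by simp only; omega)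
  rw [hfin] at h
  rw [h, Pi.zero_apply]

/-- **`dim ker(M_f(q) − t) ≤ 2` at every pin** (`q_m = 0` for `m < n`, `q_n ≠ 0`, `t = (−1)ⁿ C(n,a)² q_n²`, any tail): the map
`v ↦ (v_a, v_{n−a})` is injective on the kernel. [cite: BourbakiAlgebre1a3, Ch. III §8] [cite: BuchweitzFlenner2008HH, Prop. 6.4.4] -/
theorem finrank_ker_middleM_leading_pin_le_two [CharZero K] {n : ℕ} {q : ℕ → K} (hq0 : ∀ m, m < n → q m = 0) (hqn : q n ≠ 0)
    {a : ℕ} (ha : a ≤ n) {t : K} (ht : t = (-1 : K) ^ n * ((n.choose a : K) * (n.choose a : K)) * (q n * q n)) :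
    Module.finrank K ↥(LinearMap.ker (Matrix.toLin' (middleM n q) - t • LinearMap.id)) ≤ 2 := by
  set W := LinearMap.ker (Matrix.toLin' (middleM n q) - t • LinearMap.id) with hW
  let idx : Fin 2 → Fin (n + 1) := ![⟨a, by omega⟩, ⟨n - a, by omega⟩]
  let f : ↥W →ₗ[K] (Fin 2 → K) := (LinearMap.pi fun i : Fin 2 => LinearMap.proj (idx i)) ∘ₗ W.subtype
  have hf : Function.Injective f := by
    rw [← LinearMap.ker_eq_bot, LinearMap.ker_eq_bot']
    intro v hv
    have h0 : (v : Fin (n + 1) → K) ⟨a, by omega⟩ = 0 := by simpa [f, idx] using congr_fun hv 0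
    have h1 : (v : Fin (n + 1) → K) ⟨n - a, by omega⟩ = 0 := by simpa [f, idx] using congr_fun hv 1
    exact Subtype.ext (eq_zero_of_mem_ker_middleM_leading_pin hq0 hqn ha ht v.2 h0 h1)
  have h := LinearMap.finrank_le_finrank_of_injective hf
  rwa [Module.finrank_fin_fun] at h

/-- **the self-dual pin:** for `2a = n` (`n` even) and `t = (−1)ⁿ C(n,a)² q_n²`, `dim ker(M_f(q) − t) = 1` for `q_m = 0` (`m < n`),
`q_n ≠ 0` and ANY tail — the middle entry of a `ch(O_Z)`-shape row drops by exactly one there.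
[cite: BourbakiAlgebre1a3, Ch. III §8] [cite: BuchweitzFlenner2008HH, Prop. 6.4.4] -/
theorem finrank_ker_middleM_leading_pin_self_dual [CharZero K] {n : ℕ} {q : ℕ → K} (hq0 : ∀ m, m < n → q m = 0) (hqn : q n ≠ 0)
    {a : ℕ} (ha : 2 * a = n) {t : K} (ht : t = (-1 : K) ^ n * ((n.choose a : K) * (n.choose a : K)) * (q n * q n)) :
    Module.finrank K ↥(LinearMap.ker (Matrix.toLin' (middleM n q) - t • LinearMap.id)) = 1 := by
  have han : a ≤ n := by omega
  refine le_antisymm ?_ (one_le_finrank_ker_middleM_leading_pin hq0 han ht)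
  set W := LinearMap.ker (Matrix.toLin' (middleM n q) - t • LinearMap.id) with hW
  let f : ↥W →ₗ[K] K := (LinearMap.proj (⟨a, by omega⟩ : Fin (n + 1))) ∘ₗ W.subtype
  have hf : Function.Injective f := by
    rw [← LinearMap.ker_eq_bot, LinearMap.ker_eq_bot']
    intro v hv
    have h0 : (v : Fin (n + 1) → K) ⟨a, by omega⟩ = 0 := by simpa [f] using hv
    have h1 : (v : Fin (n + 1) → K) ⟨n - a, by omega⟩ = 0 := by
      have : (⟨n - a, by omega⟩ : Fin (n + 1)) = ⟨a, by omega⟩ := Fin.ext (by simp only; omega)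
      rw [this]; exact h0
    exact Subtype.ext (eq_zero_of_mem_ker_middleM_leading_pin hq0 hqn han ht v.2 h0 h1)
  have h := LinearMap.finrank_le_finrank_of_injective hf
  rwa [Module.finrank_self] at h

/-! ### Odd `n`: the drop is exactly `2` at every pin, for every tail (`M_f = (−1)ⁿ T_f²`, `Mod4MiddleMatrixSquareRoot`) -/

/-- **`T_f(q) − μ` is upper triangular** for `q_m = 0` (`m < n`) (`(T_f)_{ab} = (−1)^b C(n,b) q_{n−a+b}` vanishes for `b < a`).
[cite: BourbakiAlgebre1a3, Ch. III §8] -/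
theorem blockTriangular_hankelT_leading_sub {n : ℕ} {q : ℕ → K} (hq0 : ∀ m, m < n → q m = 0) (μ : K) :
    (hankelT n q - μ • (1 : Matrix (Fin (n + 1)) (Fin (n + 1)) K)).BlockTriangular id := by
  intro i j hij
  have hi := i.isLt
  have hne : i ≠ j := fun h => by rw [h] at hij; exact lt_irrefl _ hij
  rw [Matrix.sub_apply, Matrix.smul_apply, Matrix.one_apply_ne hne, smul_zero, sub_zero, hankelT]
  simp only [id] at hij
  rw [hq0 (n - (i : ℕ) + (j : ℕ)) (by omega), mul_zero]

/-- **an eigenvector of `T_f(q)` for the diagonal entry `(−1)^b C(n,b) q_n`** (`q_m = 0` for `m < n`): `det(T_f(q) − μ) = 0` for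
`μ = (−1)^b C(n,b) q_n`, so some `v ≠ 0` has `T_f(q) v = μ v`. [cite: BourbakiAlgebre1a3, Ch. III §8] -/
theorem exists_eigenvector_hankelT_leading {n : ℕ} {q : ℕ → K} (hq0 : ∀ m, m < n → q m = 0) (b : Fin (n + 1)) {μ : K}
    (hμ : μ = (-1 : K) ^ (b : ℕ) * (n.choose (b : ℕ) : K) * q n) :
    ∃ v : Fin (n + 1) → K, v ≠ 0 ∧ hankelT n q *ᵥ v = μ • v := by
  have hb := b.isLt
  have hdet : (hankelT n q - μ • (1 : Matrix (Fin (n + 1)) (Fin (n + 1)) K)).det = 0 := by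
    rw [Matrix.det_of_upperTriangular (blockTriangular_hankelT_leading_sub hq0 μ)]
    refine Finset.prod_eq_zero (Finset.mem_univ b) ?_
    rw [Matrix.sub_apply, Matrix.smul_apply, Matrix.one_apply_eq, smul_eq_mul, mul_one, hankelT, hμ]
    have hidx : n - (b : ℕ) + (b : ℕ) = n := by omega
    simp only [hidx, sub_self]
  obtain ⟨v, hv0, hv⟩ := Matrix.exists_mulVec_eq_zero_iff.mpr hdet
  refine ⟨v, hv0, ?_⟩
  rw [Matrix.sub_mulVec, Matrix.smul_mulVec, Matrix.one_mulVec, sub_eq_zero] at hv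
  exact hv

/-- **an eigenvector of `T_f(q)` with eigenvalue `μ`, `(−1)ⁿ μ² = t`, lies in `ker(M_f(q) − t)`** (`M_f = (−1)ⁿ T_f²`).
[cite: BourbakiAlgebre1a3, Ch. III §8] -/
theorem mem_ker_middleM_of_hankelT_eigenvector {n : ℕ} (q : ℕ → K) {μ t : K} (ht : t = (-1 : K) ^ n * (μ * μ))
    {v : Fin (n + 1) → K} (hv : hankelT n q *ᵥ v = μ • v) :
    v ∈ LinearMap.ker (Matrix.toLin' (middleM n q) - t • LinearMap.id) := by
  rw [toLin'_sub_smul_id, LinearMap.mem_ker, Matrix.toLin'_apply, Matrix.sub_mulVec, Matrix.smul_mulVec,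
    Matrix.one_mulVec, middleM_eq_smul_hankelT_sq, Matrix.smul_mulVec, ← Matrix.mulVec_mulVec, hv,
    Matrix.mulVec_smul, hv, smul_smul, smul_smul, ht, ← mul_assoc, sub_self]

/-- **odd `n`: `dim ker(M_f(q) − t) = 2` at EVERY pin for EVERY tail** (`q_m = 0` for `m < n`, `q_n ≠ 0`, `a ≤ n`,
`t = (−1)ⁿ C(n,a)² q_n²`, `CharZero K`): with `μ = (−1)^a C(n,a) q_n` the triangular `T_f(q)` has the eigenvalue `μ` (entry `a`)
AND `−μ` (entry `n − a`, of the other parity since `n` is odd); eigenvectors for `±μ` are independent and both lie in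
`ker(M_f(q) − t)`, so the dimension is `≥ 2`, and `≤ 2` by `finrank_ker_middleM_leading_pin_le_two` — the middle entry of a
`ch(O_Z)`-shape row on a Weil `(4m+2)`-fold drops by EXACTLY `2` at each pin (`n = 3`: `110` at `t = −q₃²` and at `t = −9q₃²`,
whatever `q₄, q₅, q₆`). [cite: BourbakiAlgebre1a3, Ch. III §8] [cite: BuchweitzFlenner2008HH, Prop. 6.4.4] -/
theorem finrank_ker_middleM_leading_pin_odd [CharZero K] {n : ℕ} (hn : Odd n) {q : ℕ → K} (hq0 : ∀ m, m < n → q m = 0)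
    (hqn : q n ≠ 0) {a : ℕ} (ha : a ≤ n) {t : K} (ht : t = (-1 : K) ^ n * ((n.choose a : K) * (n.choose a : K)) * (q n * q n)) :
    Module.finrank K ↥(LinearMap.ker (Matrix.toLin' (middleM n q) - t • LinearMap.id)) = 2 := by
  refine le_antisymm (finrank_ker_middleM_leading_pin_le_two hq0 hqn ha ht) ?_
  set W := LinearMap.ker (Matrix.toLin' (middleM n q) - t • LinearMap.id) with hW
  set μ : K := (-1 : K) ^ a * (n.choose a : K) * q n with hμ
  have hμ0 : μ ≠ 0 := mul_ne_zero (mul_ne_zero (pow_ne_zero _ (neg_ne_zero.mpr one_ne_zero))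
    (Nat.cast_ne_zero.mpr (Nat.choose_pos ha).ne')) hqn
  have htμ : t = (-1 : K) ^ n * (μ * μ) := by
    rw [ht, hμ]
    have hsq : ((-1 : K) ^ a) * ((-1 : K) ^ a) = 1 := by rw [← pow_add, ← two_mul, pow_mul, neg_one_sq, one_pow]
    linear_combination (-((-1 : K) ^ n * ((n.choose a : K) * (n.choose a : K)) * (q n * q n))) * hsq
  -- eigenvector for `μ` (diagonal entry `a`) and for `−μ` (diagonal entry `n − a`, `n` odd)
  obtain ⟨v₁, hv₁0, hv₁⟩ := exists_eigenvector_hankelT_leading hq0 (⟨a, by omega⟩ : Fin (n + 1)) (μ := μ) (by rw [hμ])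
  obtain ⟨v₂, hv₂0, hv₂⟩ := exists_eigenvector_hankelT_leading hq0 (⟨n - a, by omega⟩ : Fin (n + 1)) (μ := -μ) (by
    rw [hμ]
    simp only
    rw [Nat.choose_symm ha]
    obtain ⟨k, hk⟩ := hn
    have hpar : (-1 : K) ^ (n - a) = -(-1 : K) ^ a := by
      have h1 : (-1 : K) ^ (n - a) * (-1 : K) ^ a = -1 := by
        rw [← pow_add, show n - a + a = 2 * k + 1 by omega, pow_succ, pow_mul, neg_one_sq, one_pow, one_mul]
      have h2 : ((-1 : K) ^ a) * ((-1 : K) ^ a) = 1 := by rw [← pow_add, ← two_mul, pow_mul, neg_one_sq, one_pow]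
      linear_combination (-1 : K) ^ a * h1 - (-1 : K) ^ (n - a) * h2
    rw [hpar]
    ring)
  have hm₁ : v₁ ∈ W := mem_ker_middleM_of_hankelT_eigenvector q htμ hv₁
  have hm₂ : v₂ ∈ W := mem_ker_middleM_of_hankelT_eigenvector q (μ := -μ) (by rw [htμ]; ring) hv₂
  -- independence of eigenvectors for `μ ≠ −μ`
  have hli : LinearIndependent K ![v₁, v₂] := by
    rw [LinearIndependent.pair_iff]
    intro s r hsr
    have h1 : hankelT n q *ᵥ (s • v₁ + r • v₂) = 0 := by rw [hsr, Matrix.mulVec_zero]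
    rw [Matrix.mulVec_add, Matrix.mulVec_smul, Matrix.mulVec_smul, hv₁, hv₂] at h1
    -- `h1 : s • μ • v₁ + r • (-μ) • v₂ = 0`; combine with `μ • hsr`
    have h2 : (2 * μ * s) • v₁ = 0 := by
      have e : (2 * μ * s) • v₁ = (s • μ • v₁ + r • (-μ) • v₂) + μ • (s • v₁ + r • v₂) := by
        module
      rw [e, h1, hsr, smul_zero, add_zero]
    have hs : s = 0 := by
      rcases smul_eq_zero.mp h2 with h | h
      · simpa [hμ0] using h
      · exact absurd h hv₁0
    rw [hs, zero_smul, zero_add] at hsr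
    have hr : r = 0 := by
      rcases smul_eq_zero.mp hsr with h | h
      · exact h
      · exact absurd h hv₂0
    exact ⟨hs, hr⟩
  -- transport into the submodule
  have hliW : LinearIndependent K ![(⟨v₁, hm₁⟩ : ↥W), ⟨v₂, hm₂⟩] := by
    refine LinearIndependent.of_comp W.subtype ?_
    convert hli using 1
    funext i
    fin_cases i <;> rfl
  have h := hliW.fintype_card_le_finrank
  rwa [Fintype.card_fin] at h

end Summit.Ventures.HSemireg.Mod4
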